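import Literature.NumberTheory.LFunctions.MertensFirstChainSound
import Literature.NumberTheory.LFunctions.MertensFirstChainRun1
import Literature.NumberTheory.LFunctions.MertensFirstChainRun2
import HarnessLib

/-!
# The Mertens remainder on the certified mid range `[319, 442439]`:
# `Σ_{n ≤ x} Λ(n)/n < log x − γ + 1/(2 log x)` (STUB-PLAN `stub_windowCore`, helper A3)

Crux `WeilComb.CombShapePositivity` (item stmt-RiemannHypothesis-11229), line `Sketch`, STUB-PLAN
`stub_windowCore` Phase A, helper A3 (`psiOne_lt_midrange` of the typed companion
`Cruxes/CombShapePositivity/SketchStubPlanWindowCore.lean`).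

The tree holds the kernel-certified Rosser–Schoenfeld (3.22)-chain over the complete prime table
(`MertensFirstChainCheck/Sound/Run1/Run2.lean`): two `decide +kernel` chunks reaching the prime
`442439` (the first prime beyond `e¹³`). Its assembly announced in those files
(`MertensFirstSmallRange.lean`) was never written; this file supplies it and the consequence the
stub plan needs:

* `inv_run1`, `inv_run2` — the chain invariant `MertensFirstChain.Inv` at the primes `224743` and
  `442439` (`runDM_sound` on `run1`, `run2` from `initM_inv`);
* `rosserSchoenfeldE_ge` — `−ELO/2⁸⁰ ≤ E` from the final state (`rosserSchoenfeldE_ge_of_inv`);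
* `rs_3_22_midrange` — **(3.22) on `[319, 442439]`**: `Σ_{p ≤ x} (log p)/p < log x + E + 1/(2 log x)`;
* `sum_vonMangoldt_div_eq_primes_add_nonPrimes`, `sum_nonPrimes_le` — `Σ_{n ≤ N} Λ(n)/n` splits as
  `Σ_{p ≤ N} (log p)/p + Σ_{n ≤ N, n ∉ ℙ} Λ(n)/n`, the second part `≤ Σ_p (log p)/(p(p−1)) = −γ − E`;
* `psiOne_lt_midrange` (A3) — **`Σ_{n ≤ x} Λ(n)/n < log x − γ + 1/(2 log x)` for `319 ≤ x ≤ 442439`**,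
  i.e. `E₁(x) < 1/(2 log x) ≤ 0.0868` there (`log 319 ≥ 5.76`).
-/

noncomputable section

-- the sub-problem path RiemannHypothesis/RiemannHypothesis duplicates a namespace (D-0017)
set_option linter.dupNamespace false

open Finset ArithmeticFunction

namespace Summit.RiemannHypothesis.RiemannHypothesis.Theorems.WeilCombMertensMidrange

open Literature.NumberTheory.LFunctions MertensFirstChain MertensFirstChainRun

/-! ### The certified chain, assembled -/

/-- The chain invariant after chunk 1 (prime `224743`). [cite: RosserSchoenfeld1962, Thm. 6 (3.22)] -/
theorem inv_run1 :
    Inv ⟨224743, 14897245679027811038026167, 14897245679028286644533155,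
        13289279305559807331808632, 913176825354206810855071⟩ :=
  runDM_sound initM_inv run1

/-- The chain invariant after chunk 2 (prime `442439`, the first prime beyond `e¹³`).
[cite: RosserSchoenfeld1962, Thm. 6 (3.22)] -/
theorem inv_run2 :
    Inv ⟨442439, 15716105628607899312644944, 15716105628608374919620644,
        14107133587455640452304100, 913179468369670269995473⟩ :=
  runDM_sound inv_run1 run2

/-- **`−ELO/2⁸⁰ ≤ E`** (`E = −γ − Σ_p (log p)/(p(p−1))`, `ELO/2⁸⁰ = 1.33258…`) from the final state of the
certified run: `γ`, the certified partial sum `Ghi` and the telescoped tail beyond `442439`.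
[cite: RosserSchoenfeld1962, (2.11)] -/
theorem rosserSchoenfeldE_ge : -(ELO : ℝ) / 2 ^ 80 ≤ rosserSchoenfeldE :=
  rosserSchoenfeldE_ge_of_inv inv_run2 (by decide +kernel)

/-- **Rosser–Schoenfeld (3.22) on the certified mid range**: for real `319 ≤ x ≤ 442439`,
`Σ_{p ≤ x} (log p)/p < log x + E + 1/(2 log x)` (kernel computation over the complete prime table).
[cite: RosserSchoenfeld1962, Thm. 6 (3.22)] -/
theorem rs_3_22_midrange {x : ℝ} (hx : 319 ≤ x) (hx' : x ≤ 442439) :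
    ∑ p ∈ Nat.primesLE ⌊x⌋₊, Real.log p / p <
      Real.log x + rosserSchoenfeldE + 1 / (2 * Real.log x) :=
  eq_3_22_of_inv inv_run2 (by norm_num) rosserSchoenfeldE_ge hx (by exact_mod_cast hx')

/-! ### From the prime sum to `Σ Λ(n)/n` -/

/-- `Σ_{n ≤ N} Λ(n)/n = Σ_{p ≤ N} (log p)/p + Σ_{n ≤ N, n not prime} Λ(n)/n`. [folklore] -/
theorem sum_vonMangoldt_div_eq_primes_add_nonPrimes (N : ℕ) :
    ∑ n ∈ Finset.Icc 1 N, (Λ n : ℝ) / n =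
      (∑ p ∈ Nat.primesLE N, Real.log p / p) +
        ∑ n ∈ Finset.Ioc 0 N, (if n.Prime then 0 else (Λ n : ℝ)) / n := by
  rw [show Finset.Icc 1 N = Finset.Ioc 0 N from Finset.Icc_add_one_left_eq_Ioc 0 N]
  have h1 : ∀ n : ℕ, (Λ n : ℝ) / n =
      (if n.Prime then Real.log n / n else 0) + (if n.Prime then 0 else (Λ n : ℝ)) / n := by
    intro n
    split_ifs with hp
    · rw [vonMangoldt_apply_prime hp]; ring
    · ring
  rw [Finset.sum_congr rfl fun n _ ↦ h1 n, Finset.sum_add_distrib, ← Finset.sum_filter,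
    Nat.primesLE_eq_filter_Ioc_zero]

/-- The prime-power part is at most the full series: `Σ_{n ≤ N, n not prime} Λ(n)/n ≤ −γ − E`
(`= Σ_p (log p)/(p(p−1)) = 0.7553…`). [cite: RosserSchoenfeld1962, (2.8)] -/
theorem sum_nonPrimes_le (N : ℕ) :
    ∑ n ∈ Finset.Ioc 0 N, (if n.Prime then 0 else (Λ n : ℝ)) / n ≤
      -Real.eulerMascheroniConstant - rosserSchoenfeldE := by
  calc ∑ n ∈ Finset.Ioc 0 N, (if n.Prime then 0 else (Λ n : ℝ)) / n
      ≤ ∑' n : ℕ, (if n.Prime then 0 else (Λ n : ℝ)) / n :=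
        RosserSchoenfeld.summable_vonMangoldt_nonPrime_div.sum_le_tsum _ fun k _ ↦ by
          positivity [vonMangoldt_nonneg (n := k)]
    _ = ∑' p : Nat.Primes, Real.log (p : ℝ) / ((p : ℝ) * ((p : ℝ) - 1)) :=
        RosserSchoenfeld.tsum_vonMangoldt_nonPrime_div
    _ = -Real.eulerMascheroniConstant - rosserSchoenfeldE :=
        hasSum_primes_log_div_mul_pred.tsum_eq

/-- **A3 (STUB-PLAN `stub_windowCore`): the Mertens remainder on the certified mid range.** For real
`319 ≤ x ≤ 442439`, `Σ_{n ≤ x} Λ(n)/n < log x − γ + 1/(2 log x)`, i.e. `E₁(x) < 1/(2 log x)` there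
((3.22) for the primes, the full series `Σ_p (log p)/(p(p−1)) = −γ − E` for the prime powers).
[cite: RosserSchoenfeld1962, Thm. 6 (3.22) with (2.8)] -/
theorem psiOne_lt_midrange {x : ℝ} (hx : 319 ≤ x) (hx' : x ≤ 442439) :
    ∑ n ∈ Finset.Icc 1 ⌊x⌋₊, (Λ n : ℝ) / n <
      Real.log x - Real.eulerMascheroniConstant + 1 / (2 * Real.log x) := by
  rw [sum_vonMangoldt_div_eq_primes_add_nonPrimes]
  have h1 := rs_3_22_midrange hx hx'
  have h2 := sum_nonPrimes_le ⌊x⌋₊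
  linarith

/-- **Stub `stub_mertensMidrange` (STUB-PLAN `stub_windowCore`, helper A3; registered on crux
stmt-RiemannHypothesis-11229)**: the uncurried registered form of `psiOne_lt_midrange`.
[cite: RosserSchoenfeld1962, Thm. 6 (3.22) with (2.8)] -/
theorem stub_mertensMidrange : ∀ x : ℝ, 319 ≤ x → x ≤ 442439 →
    ∑ n ∈ Finset.Icc 1 ⌊x⌋₊, (ArithmeticFunction.vonMangoldt n : ℝ) / n <
      Real.log x - Real.eulerMascheroniConstant + 1 / (2 * Real.log x) :=
  fun _ hx hx' ↦ psiOne_lt_midrange hx hx'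

/-- `1/(2 log x) ≤ 0.0868` for `x ≥ 319` (`log 319 ≥ 5.7604`), so that on the mid range
`E₁(x) < 0.0868`. [folklore] -/
theorem one_div_two_log_le {x : ℝ} (hx : 319 ≤ x) : 1 / (2 * Real.log x) ≤ 0.0868 := by
  have hlog : (5.7604 : ℝ) ≤ Real.log x := by
    have h319 : (5.7604 : ℝ) ≤ Real.log 319 := by
      rw [Real.le_log_iff_exp_le (by norm_num)]
      have h1 : Real.exp 1 < 2.7182818286 := Real.exp_one_lt_d9
      have h07 : Real.exp (0.7604 : ℝ) ≤ 2.1393 := by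
        -- exp(0.7604) = exp(0.5) * exp(0.2604); each factor by Mathlib's Taylor bound `exp_bound`
        have ha : Real.exp (1 / 2 : ℝ) ≤ 1.64875 := by
          have := Real.exp_bound (x := (1 / 2 : ℝ)) (by norm_num) (n := 5) (by norm_num)
          simp only [Finset.sum_range_succ, Finset.sum_range_zero, Nat.factorial] at this
          have habs := abs_sub_le_iff.1 this
          norm_num at habs
          linarith [habs.1]
        have hb : Real.exp (0.2604 : ℝ) ≤ 1.2975 := by
          have := Real.exp_bound (x := (0.2604 : ℝ)) (by norm_num) (n := 4) (by norm_num)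
          simp only [Finset.sum_range_succ, Finset.sum_range_zero, Nat.factorial] at this
          have habs := abs_sub_le_iff.1 this
          norm_num at habs
          linarith [habs.1]
        have he : Real.exp (0.7604 : ℝ) = Real.exp (1 / 2) * Real.exp 0.2604 := by
          rw [← Real.exp_add]; norm_num
        rw [he]
        calc Real.exp (1 / 2) * Real.exp 0.2604 ≤ 1.64875 * 1.2975 :=
              mul_le_mul ha hb (Real.exp_pos _).le (by norm_num)
          _ ≤ 2.1393 := by norm_num
      have he5 : Real.exp (5.7604 : ℝ) = Real.exp 1 ^ 5 * Real.exp 0.7604 := by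
        rw [← Real.exp_nat_mul, ← Real.exp_add]; norm_num
      rw [he5]
      have h5 : Real.exp 1 ^ 5 ≤ (2.7182818286 : ℝ) ^ 5 :=
        pow_le_pow_left₀ (Real.exp_pos 1).le h1.le 5
      calc Real.exp 1 ^ 5 * Real.exp 0.7604 ≤ (2.7182818286 : ℝ) ^ 5 * 2.1393 :=
            mul_le_mul h5 h07 (Real.exp_pos _).le (by positivity)
        _ ≤ 319 := by norm_num
    exact h319.trans (Real.log_le_log (by norm_num) hx)
  rw [div_le_iff₀ (by linarith)]
  nlinarith

end Summit.RiemannHypothesis.RiemannHypothesis.Theorems.WeilCombMertensMidrange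

end
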